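import Summits.ABC.IUTFork.Repair.RHQ3L0Exact
import Summits.ABC.IUTFork.Repair.RHInSigmaDatum
import HarnessLib

/-!
# D-0079 RESCUE sub-cell R-H, ROUND 2 Q3 / MIN-SLICE (iv) WINDOW regime — the SLIVER LAW in kernel, part 1 (integers, per place):
# «a place in Σ₈ is LOCALLY LOG-SZPIRO at EVERY `l`»: `−r♯ < e_w·⌊log_p e_w⌋`, and the row-8 cell forces `(l−3)·ord_v(q_v) < 4·l·e(v|p)·(1 + ⌊log_p e_w⌋)`

PROOF-ONLY companion (0 definitions) of `RHHeightClass` (abc-iut-rh-typ-8: `StrictMinPow`, `CertVal`, `HBand`), `RHQ3LTailBand`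
(abc-iut-rh2-q3-typ-1), `RHQ3L0Exact` (this seat, gen 3) and `RHInSigmaDatum` (abc-iut-rh2-xi-2: `InSigma8 D := HBand (pilotDataOfK D K)`).
Seat abc-iut-rh-typ-2 gen 4 (Q3-typ lane, rh-lead R13; rung LADDER-ABC:A2.RESCUE.H), typing the «kernel shape for the typ lane: three inequalities»
posted by abc-iut-rh-num-1 g2 2026-08-27T00:34:44Z (`plan/rescue/R-H/Q3-SLIVER-rh-num-1.tsv` 4b2699061260dc1d, engine `q3/q3sliver.py` 310d672245007168,
`Q3-ASYMPTOTICS-rh-num-1.md` v1.7 §4e; pre-read by abc-iut-rh2-ref-3 00:54:23Z (e): «derivation steps (1)–(3) are elementary and the binding case is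
N ≈ h/ln h bad primes»):

> «(1) per place the row-8 top cell with −r♯ < e_w·log_p e_w gives H_p ≤ 4·(1 + log_p(e_v·l))·(1 + O(1/l)); (2) summing, h = Σ_p H_p ln p ≤
> 4(1+O(1/l))·[ln rad + N·ln(E·l)]; (3) ln rad ≥ ln N! ≥ N(ln N − 1) … in the window the kept slice meets the Szpiro-bad locus only in a SLIVER of
> Szpiro ratios (6, 6 + ε(h)], ε → 0.»

THIS FILE = step (1) in the integer-clean form abc-iut-rh-num-1 confirmed 01:12:38Z/01:12:56Z («−r♯ ≤ T·e_w, H_p ≤ 4(1+T)·l/(l−3)»; here with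
`T = ⌊log_p e_w⌋` and STRICT, at every `l ≥ 5`); steps (2)–(3) and the SLIVER disjunction (reals, an abstract finite set of bad primes) are the companion
`RHQ3SliverSum`, and the one-import bridge at the genuine datum is `RHQ3SliverGenuine` (same seat).
PRIOR ART IN TREE, BY NAME (abc-iut-rh2-q3-typ-1 g2, `RHQ3LTailSigma8Window`, p479646, landed FIRST 2026-08-27T00:55Z; DEDUP MAP agreed on the bus 01:17:46Z /
01:23:36Z): `RH.Q3LTailSigma8.strictMin_index_le_log_succ` (≡ in content `minimiser_le_log_succ` below, theirs has precedence), `certVal_ge_neg_log_mul`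
(`r ≥ −(⌊log_p e⌋+1)·e` — `neg_lt_mul_log_of_certVal` below is the strict sharpening `−r < e·⌊log_p e⌋`), `not_inSigma8_of_heavy`
(`4l·e(v|p)·(⌊log_p e_w⌋+2) + 2 ≤ (l−3)·ord_v(q_v) ⟹ ¬InSigma8 D` — `qParamOrd_lt_of_inSigma8` below is the contrapositive sharpened by `4l·e(v|p) + 2`).
* §1 THE MEMBER VALUATION IS NEVER VERY NEGATIVE, AT EVERY `l`. `minimiser_le_log_succ`: a strict minimiser `t⋆` of `t ↦ p^t − t·e` (`p ≥ 2`) has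
  `t⋆ ≤ ⌊log_p e⌋ + 1`; `neg_lt_mul_log_of_strictMinPow`: **`−r♯ < e·⌊log_p e⌋`** (one `e` sharper than `KLine.strictMinPow_ge_neg_of_lt` at `T = ⌊log_p e⌋+1`,
  and with NO hypothesis placing `e` on a piece); `neg_lt_mul_log_of_certVal`: the same for BOTH branches of a certified member valuation (`CertVal`:
  untied `r♯`, or the fallback `r = e`). `topCell_lt_of_neg_lt`: the row-8 cell `(j²−1)·m ≤ j·(e − r) + (1 − r)` at a label `j ≥ 1` with `−r < B` forces
  `(j−1)·m < e + B`; hence **`cell_lt_mul_log_succ`: `(j−1)·m < e·(1 + ⌊log_p e⌋)`** for every certified `r` — valid at EVERY label and EVERY `l`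
  (no `l⋆ ≥ 3T+4` side condition as in `Q3LTailBand.not_hexSlice_of_k_ge`, whose sharper constant `2T+2` needs it); `topCell_lt_mul_log_succ_l`
  (`l`-currency: `(l−3)·m < 2e·(1 + ⌊log_p e⌋)`); HEX currency (`m = k·ε`, `e = l·ε`): `hexSlice_lt`: `(l⋆−1)·k < l·(1 + ⌊log_p e⌋)`, i.e.
  `k₀(p, e, l) < 2(1 + ⌊log_p e⌋)·(1 + 3/(l−3))`.
* §2 AT THE GENUINE DATUM `Cor312Prov.pilotDataOfK D K`, INPUT-FREE («Σ₈ ⟹ LOCALLY LOG-SZPIRO», integer form): `label_mul_qParamOrd_lt_of_cell_pilotDataOfK`: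
  the row-8 cell at label `j = i+1` of a bad place `w ∣ p` over `v` forces `i·ord_v(q_v) < 2·l·e(v|p)·(1 + ⌊log_p e_w⌋)` (`2l·P_q(w) = e(w|v)·ord_v(q_v)`,
  `e_w = e(v|p)·e(w|v)` — the factor `e(w|v)` CANCELS, so no `e(w|v) = l` input is needed); at the top label
  **`qParamOrd_lt_of_hBand_pilotDataOfK` / `qParamOrd_lt_of_inSigma8`: `HBand (pilotDataOfK D K)` (= `InSigma8 D`) ⟹ at every bad place
  `(l−3)·ord_v(q_v) < 4·l·e(v|p)·(1 + ⌊log_p e_w⌋)`**; in local-height currency `localHeight_lt_of_hBand_pilotDataOfK`: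
  `((l−3) : ℝ)·(ord_v(q_v)/e(v|p)) < 4l·(1 + ⌊log_p e_w⌋)` and `pow_log_ramIdx_le` (`p^{⌊log_p e_w⌋} ≤ e_w`) — exactly the per-prime hypotheses `hplace` /
  `hX` (any `X ≥ max_w e_w`) of `RHQ3SliverSum.sliver`.
HONEST SCOPE: `HBand` / `InSigma8` is row 8's claim-tagged HYPOTHESIS (abc-iut-lens-strengthen-1 / abc-iut-rh-typ-8 / abc-iut-rh2-xi-2), never asserted;
«in Σ₈» = the hypothesis holds as typed; the theorems say what it FORCES at a genuine place. cf. abc-iut-lens-transfer-1's Szpiro-currency reading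
«Σ-truth is locally log-Szpiro, H_p(w) ≲ 4·log_p e_w» (CARD-log-szpiro, staging, candidate vocabulary — not imported). Nothing here asserts abc;
TAKES NO SIDE on [IUTchIII] Cor. 3.12 or on any author.
[cite: Mochizuki2012, IUTchI Def. 3.1 (b)(c)(e) pp. 61–62, Ex. 3.2 (iv) p. 71; IUTchIV Prop. 1.2 (i)(ii) p. 10] [cite: DupuyHilado2025, §3.3–3.4]
[claim: Mochizuki2012, status: disputed] for every IUT locution; the arithmetic is [folklore].
-/

noncomputable section

open Set Function NumberField IsDedekindDomain

namespace Summit.ABC.IUTFork.Repair.RH.Q3Sliver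

open Summit.ABC.IUTFork.Repair.RHHeightClass Summit.ABC.IUTFork.Repair.RH.Q3LTailBand Summit.ABC.IUTFork.Repair.RH.Q3L0Exact
open Literature.IUT.LogThetaLattice Literature.IUT.LogVolume Literature.IUT.HodgeTheaters
open Summit.ABC.IUTFork.Thm311 Summit.ABC.IUTFork.Thm311.Real Summit.ABC.IUTFork.Cor312Prov

/-! ## §1. The certified member valuation is never very negative: `−r < e·⌊log_p e⌋`, at every `l` -/

/-- **The strict minimiser sits at or below `⌊log_p e⌋ + 1`.** If `t⋆` is a STRICT minimiser of `t ↦ p^t − t·e` (`p ≥ 2`) then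
`t⋆ ≤ ⌊log_p e⌋ + 1`: for `t⋆ ≥ ⌊log_p e⌋ + 2` the previous value is smaller, `g(t⋆) − g(t⋆−1) = p^{t⋆−1}(p−1) − e ≥ p^{⌊log_p e⌋+1} − e > 0`. [folklore] -/
theorem minimiser_le_log_succ {p e t₀ : ℕ} (hp : 2 ≤ p)
    (hmin : ∀ t' : ℕ, t' ≠ t₀ → (p : ℤ) ^ t₀ - t₀ * e < (p : ℤ) ^ t' - t' * e) :
    t₀ ≤ Nat.log p e + 1 := by
  by_contra h
  obtain ⟨s, rfl⟩ : ∃ s, t₀ = s + 1 := ⟨t₀ - 1, by omega⟩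
  have hs : Nat.log p e + 1 ≤ s := by omega
  have hlt := hmin s (by omega)
  have he : (e : ℤ) < (p : ℤ) ^ (Nat.log p e + 1) := by
    exact_mod_cast Nat.lt_pow_succ_log_self (by omega : 1 < p) e
  have hpow : (p : ℤ) ^ (Nat.log p e + 1) ≤ (p : ℤ) ^ s := pow_le_pow_right₀ (by omega) hs
  have hps : (0 : ℤ) < (p : ℤ) ^ s := by positivity
  have h1 : (p : ℤ) ^ (s + 1) = (p : ℤ) ^ s * p := pow_succ _ _
  rw [h1] at hlt
  push_cast at hlt
  have hp1 : (1 : ℤ) ≤ (p : ℤ) - 1 := by omega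
  nlinarith

/-- **`−r♯ < e·⌊log_p e⌋` — THE UNTIED MEMBER VALUATION IS NEVER VERY NEGATIVE** (`p ≥ 2`, every `e`, no piece hypothesis). With `t⋆ ≤ ⌊log_p e⌋ + 1`
(`minimiser_le_log_succ`): if `t⋆ ≤ ⌊log_p e⌋` then `−r♯ = t⋆·e − p^{t⋆} < t⋆·e ≤ e·⌊log_p e⌋`; if `t⋆ = ⌊log_p e⌋ + 1` then `p^{t⋆} > e` and
`−r♯ < t⋆·e − e = e·⌊log_p e⌋`. One `e` sharper than `KLine.strictMinPow_ge_neg_of_lt` (abc-iut-rh-typ-8) at `T = ⌊log_p e⌋ + 1`; it is abc-iut-rh-num-1's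
«−r♯ < e_w·log_p e_w» with the INTEGER logarithm. [folklore] -/
theorem neg_lt_mul_log_of_strictMinPow {p e : ℕ} {r : ℤ} (hp : 2 ≤ p) (hr : StrictMinPow p e r) :
    -r < (e : ℤ) * (Nat.log p e : ℕ) := by
  obtain ⟨t₀, ht₀, hmin⟩ := hr
  have hmin' : ∀ t' : ℕ, t' ≠ t₀ → (p : ℤ) ^ t₀ - t₀ * e < (p : ℤ) ^ t' - t' * e := by
    intro t' ht'; rw [ht₀]; exact hmin t' ht'
  have hle : t₀ ≤ Nat.log p e + 1 := minimiser_le_log_succ hp hmin'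
  have he : (e : ℤ) < (p : ℤ) ^ (Nat.log p e + 1) := by
    exact_mod_cast Nat.lt_pow_succ_log_self (by omega : 1 < p) e
  have hpt : (0 : ℤ) < (p : ℤ) ^ t₀ := by positivity
  have he0 : (0 : ℤ) ≤ (e : ℤ) := by positivity
  rw [← ht₀]
  rcases Nat.lt_or_ge t₀ (Nat.log p e + 1) with hlt | hge
  · have h1 : (t₀ : ℤ) ≤ (Nat.log p e : ℕ) := by exact_mod_cast Nat.lt_succ_iff.mp hlt
    nlinarith
  · have heq : t₀ = Nat.log p e + 1 := le_antisymm hle hge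
    rw [heq]
    push_cast
    nlinarith

/-- **The same for EVERY certified member valuation** (`CertVal p e r`: the untied `r♯`, or the fallback `r = e ≥ 1`, for which `−e < 0 ≤ e·⌊log_p e⌋`).
[folklore] -/
theorem neg_lt_mul_log_of_certVal {p e : ℕ} {r : ℤ} (hp : 2 ≤ p) (he : 1 ≤ e) (hr : CertVal p e r) :
    -r < (e : ℤ) * (Nat.log p e : ℕ) := by
  rcases hr with h | h
  · exact neg_lt_mul_log_of_strictMinPow hp h
  · subst h
    have : (0 : ℤ) ≤ (e : ℤ) * (Nat.log p e : ℕ) := by positivity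
    have he' : (1 : ℤ) ≤ (e : ℤ) := by exact_mod_cast he
    linarith

/-- **THE ROW-8 CELL FORCES A LINEAR HEIGHT BOUND.** At a label `j ≥ 1`, if `−r < B` and `e ≥ 0` then the cell `(j²−1)·m ≤ j·(e − r) + (1 − r)` gives
`(j−1)·m < e + B`: indeed `(j+1)(j−1)·m ≤ j·e + (j+1)(B−1) + 1 < (j+1)(e + B)`. [folklore] -/
theorem topCell_lt_of_neg_lt {ls : ℕ} {e r m B : ℤ} (hB : -r < B) (he : 0 ≤ e) (hls : 1 ≤ ls)
    (hcell : (((ls : ℤ)) ^ 2 - 1) * m ≤ (ls : ℤ) * (e - r) + (1 - r)) :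
    ((ls : ℤ) - 1) * m < e + B := by
  have hls' : (1 : ℤ) ≤ (ls : ℤ) := by exact_mod_cast hls
  have h : ((ls : ℤ) + 1) * (((ls : ℤ) - 1) * m) < ((ls : ℤ) + 1) * (e + B) := by nlinarith
  exact lt_of_mul_lt_mul_left h (by linarith)

/-- **PER-PLACE HEIGHT LAW, integers, every label and every `l`: `(j−1)·m < e·(1 + ⌊log_p e⌋)`** whenever the row-8 cell holds at label `j` with a
certified member valuation (`p ≥ 2`, `e ≥ 1`). abc-iut-rh-num-1's step (1). [folklore] -/
theorem cell_lt_mul_log_succ {p e ls : ℕ} {r m : ℤ} (hp : 2 ≤ p) (he : 1 ≤ e) (hls : 1 ≤ ls) (hr : CertVal p e r)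
    (hcell : (((ls : ℤ)) ^ 2 - 1) * m ≤ (ls : ℤ) * ((e : ℤ) - r) + (1 - r)) :
    ((ls : ℤ) - 1) * m < (e : ℤ) * (1 + (Nat.log p e : ℕ)) := by
  have := topCell_lt_of_neg_lt (neg_lt_mul_log_of_certVal hp he hr) (by positivity) hls hcell
  linarith

/-- **The law in `l`-currency** (`l = 2l⋆ + 1`, top label `j = l⋆`): `(l − 3)·m < 2·e·(1 + ⌊log_p e⌋)`. [folklore] -/
theorem topCell_lt_mul_log_succ_l {p e ls : ℕ} {r m : ℤ} (hp : 2 ≤ p) (he : 1 ≤ e) (hls : 1 ≤ ls) (hr : CertVal p e r)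
    (hcell : (((ls : ℤ)) ^ 2 - 1) * m ≤ (ls : ℤ) * ((e : ℤ) - r) + (1 - r)) :
    ((2 * (ls : ℤ) + 1) - 3) * m < 2 * (e : ℤ) * (1 + (Nat.log p e : ℕ)) := by
  have := cell_lt_mul_log_succ hp he hls hr hcell
  linarith

/-- **HEX currency** (abc-iut-rh-typ-8's slice `hexSlice_iff`: `m_q = k·ε`, `e = l·ε = (2l⋆+1)·ε`, `ε ≥ 1`): the top cell at a certified member valuation
forces `(l⋆ − 1)·k < (2l⋆ + 1)·(1 + ⌊log_p e⌋)`, i.e. `k₀(p, e, l) < 2·(1 + ⌊log_p e⌋)·l/(l − 3)` at EVERY `l ≥ 5` — the one-sided companion, uniform in `l`,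
of `Q3LTailBand.not_hexSlice_of_k_ge` (`k₀ ≤ 2t⋆ + 2` for `l⋆ ≥ 3t⋆ + 4`). [folklore] -/
theorem hexSlice_lt {p ls ε : ℕ} {k r : ℤ} (hp : 2 ≤ p) (hls : 1 ≤ ls) (hε : 1 ≤ ε)
    (hr : CertVal p ((2 * ls + 1) * ε) r)
    (hcell : (((ls : ℤ)) ^ 2 - 1) * (k * ε) ≤ (ls : ℤ) * ((((2 * ls + 1) * ε : ℕ) : ℤ) - r) + (1 - r)) :
    ((ls : ℤ) - 1) * k < (2 * (ls : ℤ) + 1) * (1 + (Nat.log p ((2 * ls + 1) * ε) : ℕ)) := by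
  have he1 : 1 ≤ (2 * ls + 1) * ε := by nlinarith
  have key := cell_lt_mul_log_succ hp he1 hls hr hcell
  push_cast at key
  -- `(l⋆−1)·k·ε < (2l⋆+1)·ε·(1+T)`: cancel `ε ≥ 1`
  set T : ℤ := ((Nat.log p ((2 * ls + 1) * ε) : ℕ) : ℤ) with hT
  have hT0 : 0 ≤ T := by positivity
  have hε' : (1 : ℤ) ≤ (ε : ℤ) := by exact_mod_cast hε
  by_contra hcon
  rw [not_lt] at hcon
  have : (2 * (ls : ℤ) + 1) * (1 + T) * (ε : ℤ) ≤ ((ls : ℤ) - 1) * k * (ε : ℤ) :=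
    mul_le_mul_of_nonneg_right hcon (by linarith)
  nlinarith

/-! ## §2. At the genuine `K`-level datum: «Σ₈ ⟹ locally log-Szpiro», input-free -/

section Genuine

variable {F K Fbar : Type} [Field F] [NumberField F] [Field K] [NumberField K] [Algebra F K] [Field Fbar]
  [Algebra F Fbar] [Algebra K Fbar] {E : WeierstrassCurve F} [E.IsElliptic] {l : ℕ} {Pb : BadPlacePredicates K}
  (D : InitialThetaData F K Fbar E l Pb)

/-- **THE ROW-8 CELL AT A GENUINE PLACE BOUNDS THE LOCAL HEIGHT, INPUT-FREE.** At a bad place `w ∣ p` of `pilotDataOfK D K` over the place `v` of `F`,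
if the row-8 cell holds at the label `j = i + 1` for some certified member valuation `r` (`CertVal p e_w r`), then
`i·ord_v(q_v) < 2·l·e(v|p)·(1 + ⌊log_p e_w⌋)`: the integer law `cell_lt_mul_log_succ` (`i·P_q(w) < e_w·(1 + ⌊log_p e_w⌋)`) multiplied by `2l`, using
`2l·P_q(w) = e(w|v)·ord_v(q_v)` (`exists_nat_qPilot_pilotDataOfK`) and `e_w = e(v|p)·e(w|v)` — the factor `e(w|v) > 0` cancels, so NO hypothesis
`e(w|v) = l` is needed (contrast `Q3L0Exact.hBandClauses_pilotDataOfK_iff_quad`). [cite: Mochizuki2012, IUTchI Def. 3.1 (e) p. 62, Ex. 3.2 (iv) p. 71]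
[claim: Mochizuki2012, status: disputed] — the cell is row 8's hypothesis shape; nothing asserted. -/
theorem label_mul_qParamOrd_lt_of_cell_pilotDataOfK (pp : Nat.Primes) (i : Fin (pilotDataOfK D K).lstar)
    (w : (thetaIndex (pilotDataOfK D K)).Fibre (.inr pp))
    (hw : haveI : Fact (pp : ℕ).Prime := ⟨pp.2⟩; placeOf (pilotDataOfK D K) pp.1 w ∈ (pilotDataOfK D K).S)
    (r : ℤ) (hr : haveI : Fact (pp : ℕ).Prime := ⟨pp.2⟩; CertVal pp (ramIdx K (placeOf (pilotDataOfK D K) pp.1 w)) r)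
    (hcell : haveI : Fact (pp : ℕ).Prime := ⟨pp.2⟩;
      ((((i : ℕ) : ℝ) + 1) ^ 2 - 1) * (pilotDataOfK D K).qPilot (placeOf (pilotDataOfK D K) pp.1 w)
        ≤ (((i : ℕ) : ℝ) + 1) * ((ramIdx K (placeOf (pilotDataOfK D K) pp.1 w) : ℝ) - r) + (1 - r)) :
    haveI : Fact (pp : ℕ).Prime := ⟨pp.2⟩
    (i : ℕ) * qParamOrd E (finBelow F K (placeOf (pilotDataOfK D K) pp.1 w)) <
      2 * l * ramIdx F (finBelow F K (placeOf (pilotDataOfK D K) pp.1 w)) *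
        (1 + Nat.log (pp : ℕ) (ramIdx K (placeOf (pilotDataOfK D K) pp.1 w))) := by
  haveI hF : Fact (pp : ℕ).Prime := ⟨pp.2⟩
  set w₀ := placeOf (pilotDataOfK D K) pp.1 w with hw₀
  set v := finBelow F K w₀ with hv
  obtain ⟨P, hP, -, h2lP⟩ := exists_nat_qPilot_pilotDataOfK D hw
  have htower : w₀.asIdeal.ramificationIdx ℤ = ramIdx F v * Ideal.ramificationIdx' v.asIdeal w₀.asIdeal :=
    ThetaData.absRamificationIdx_eq_ramIdx_mul (F := F) w₀
  have hVF : FinitePlace.mk v ∈ D.VFbad := (mem_pilotDataOfK_S_iff D K w₀).mp hw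
  have hlr : l ≤ Ideal.ramificationIdx' v.asIdeal w₀.asIdeal := ThetaData.l_le_ramificationIdx_of_under_mem_VFbad D hVF
  have he0 : 0 < ramIdx F v := Nat.pos_of_ne_zero (ramIdx_ne_zero F v)
  have heq : ramIdx K w₀ = w₀.asIdeal.ramificationIdx ℤ := ramIdx_eq K w₀
  have h5 : 5 ≤ l := D.five_le_l
  have hewv : 0 < Ideal.ramificationIdx' v.asIdeal w₀.asIdeal := lt_of_lt_of_le (by omega) hlr
  have hew1 : 1 ≤ ramIdx K w₀ := by rw [heq, htower]; exact Nat.mul_pos he0 hewv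
  have hp : 2 ≤ (pp : ℕ) := pp.2.two_le
  -- the cell as an INTEGER inequality (`m_q(w) = P`, `e_w`, `r` are integers)
  have hcellZ : ((((i : ℕ) : ℤ) + 1) ^ 2 - 1) * (P : ℤ) ≤ (((i : ℕ) : ℤ) + 1) * ((ramIdx K w₀ : ℤ) - r) + (1 - r) := by
    rw [hP] at hcell
    have h' : (((((i : ℕ) : ℤ) + 1) ^ 2 - 1) * (P : ℤ) : ℤ) ≤ ((((i : ℕ) : ℤ) + 1) * ((ramIdx K w₀ : ℤ) - r) + (1 - r) : ℤ) := by
      have := hcell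
      exact_mod_cast this
    exact h'
  have key := cell_lt_mul_log_succ (ls := (i : ℕ) + 1) (m := (P : ℤ)) hp hew1 (by omega) hr (by push_cast; exact hcellZ)
  have keyZ : ((i : ℕ) : ℤ) * (P : ℤ) < (ramIdx K w₀ : ℤ) * (1 + (Nat.log (pp : ℕ) (ramIdx K w₀) : ℕ)) := by
    push_cast at key
    linarith
  have keyN : (i : ℕ) * P < ramIdx K w₀ * (1 + Nat.log (pp : ℕ) (ramIdx K w₀)) := by exact_mod_cast keyZ
  -- multiply by `2l`, rewrite `2l·P = e(w|v)·ord_v(q_v)` and `e_w = e(v|p)·e(w|v)`, cancel `e(w|v)`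
  have hl0 : 0 < 2 * l := by omega
  have hmul : Ideal.ramificationIdx' v.asIdeal w₀.asIdeal * ((i : ℕ) * qParamOrd E v) <
      Ideal.ramificationIdx' v.asIdeal w₀.asIdeal * (2 * l * ramIdx F v * (1 + Nat.log (pp : ℕ) (ramIdx K w₀))) := by
    calc Ideal.ramificationIdx' v.asIdeal w₀.asIdeal * ((i : ℕ) * qParamOrd E v)
        = (i : ℕ) * (Ideal.ramificationIdx' v.asIdeal w₀.asIdeal * qParamOrd E v) := by ring
      _ = (i : ℕ) * (2 * l * P) := by rw [← h2lP]
      _ = 2 * l * ((i : ℕ) * P) := by ring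
      _ < 2 * l * (ramIdx K w₀ * (1 + Nat.log (pp : ℕ) (ramIdx K w₀))) := (Nat.mul_lt_mul_left hl0).2 keyN
      _ = Ideal.ramificationIdx' v.asIdeal w₀.asIdeal * (2 * l * ramIdx F v * (1 + Nat.log (pp : ℕ) (ramIdx K w₀))) := by
          rw [heq, htower]; ring
  exact Nat.lt_of_mul_lt_mul_left hmul

/-- **«Σ₈ ⟹ LOCALLY LOG-SZPIRO» — `HBand (pilotDataOfK D K)` BOUNDS EVERY BAD LOCAL HEIGHT, at every `l`, input-free:** at every bad place `w ∣ p` over `v`,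
`(l − 3)·ord_v(q_v) < 4·l·e(v|p)·(1 + ⌊log_p e_w⌋)` (the top label `j = l⋆ = (l−1)/2` of `label_mul_qParamOrd_lt_of_cell_pilotDataOfK`; `e_w ≤ [K:ℚ]`).
abc-iut-rh-num-1's step (1) at the genuine datum; cf. abc-iut-lens-transfer-1's Szpiro-currency reading «H_p(w) ≲ 4·log_p e_w» (CARD-log-szpiro, staging).
[cite: Mochizuki2012, IUTchI Def. 3.1 (b)(c)(e) pp. 61–62, Ex. 3.2 (iv) p. 71] [claim: Mochizuki2012, status: disputed] — `HBand` is row 8's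
HYPOTHESIS; this is what it forces, nothing asserted. -/
theorem qParamOrd_lt_of_hBand_pilotDataOfK (h : HBand (pilotDataOfK D K)) (pp : Nat.Primes)
    (w : (thetaIndex (pilotDataOfK D K)).Fibre (.inr pp))
    (hw : haveI : Fact (pp : ℕ).Prime := ⟨pp.2⟩; placeOf (pilotDataOfK D K) pp.1 w ∈ (pilotDataOfK D K).S) :
    haveI : Fact (pp : ℕ).Prime := ⟨pp.2⟩
    (l - 3) * qParamOrd E (finBelow F K (placeOf (pilotDataOfK D K) pp.1 w)) <
      4 * l * ramIdx F (finBelow F K (placeOf (pilotDataOfK D K) pp.1 w)) *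
        (1 + Nat.log (pp : ℕ) (ramIdx K (placeOf (pilotDataOfK D K) pp.1 w))) := by
  haveI hF : Fact (pp : ℕ).Prime := ⟨pp.2⟩
  have hl := two_mul_lstar_add_one_pilotDataOfK D
  have h5 : 5 ≤ l := D.five_le_l
  have hls : 2 ≤ (pilotDataOfK D K).lstar := by omega   -- (= `RHLabelCutJ2Genuine.two_le_lstar`, not imported)
  obtain ⟨-, -, r, hr, hcell⟩ := h pp ⟨(pilotDataOfK D K).lstar - 1, by omega⟩ w hw
  have key := label_mul_qParamOrd_lt_of_cell_pilotDataOfK D pp ⟨(pilotDataOfK D K).lstar - 1, by omega⟩ w hw r hr hcell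
  have h3 : l - 3 = 2 * ((pilotDataOfK D K).lstar - 1) := by omega
  rw [h3]
  calc 2 * ((pilotDataOfK D K).lstar - 1) * qParamOrd E (finBelow F K (placeOf (pilotDataOfK D K) pp.1 w))
      = 2 * (((pilotDataOfK D K).lstar - 1) * qParamOrd E (finBelow F K (placeOf (pilotDataOfK D K) pp.1 w))) := by ring
    _ < 2 * (2 * l * ramIdx F (finBelow F K (placeOf (pilotDataOfK D K) pp.1 w)) *
          (1 + Nat.log (pp : ℕ) (ramIdx K (placeOf (pilotDataOfK D K) pp.1 w)))) := by
        have := key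
        simpa using (Nat.mul_lt_mul_left (by norm_num : 0 < 2)).2 this
    _ = 4 * l * ramIdx F (finBelow F K (placeOf (pilotDataOfK D K) pp.1 w)) *
          (1 + Nat.log (pp : ℕ) (ramIdx K (placeOf (pilotDataOfK D K) pp.1 w))) := by ring

/-- **The same from `InSigma8 D`** (abc-iut-rh2-xi-2's datum-class predicate, `:= HBand (pilotDataOfK D K)`). [claim: Mochizuki2012, status: disputed] —
`InSigma8` is a hypothesis; nothing asserted. -/
theorem qParamOrd_lt_of_inSigma8 (h : InSigmaDatum.InSigma8 D) (pp : Nat.Primes)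
    (w : (thetaIndex (pilotDataOfK D K)).Fibre (.inr pp))
    (hw : haveI : Fact (pp : ℕ).Prime := ⟨pp.2⟩; placeOf (pilotDataOfK D K) pp.1 w ∈ (pilotDataOfK D K).S) :
    haveI : Fact (pp : ℕ).Prime := ⟨pp.2⟩
    (l - 3) * qParamOrd E (finBelow F K (placeOf (pilotDataOfK D K) pp.1 w)) <
      4 * l * ramIdx F (finBelow F K (placeOf (pilotDataOfK D K) pp.1 w)) *
        (1 + Nat.log (pp : ℕ) (ramIdx K (placeOf (pilotDataOfK D K) pp.1 w))) :=
  qParamOrd_lt_of_hBand_pilotDataOfK D ((InSigmaDatum.inSigma8_iff D).1 h) pp w hw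

/-- **Local-height currency** (`H_v := ord_v(q_v)/e(v|p)`, reals): `HBand (pilotDataOfK D K)` forces `(l − 3)·H_v < 4l·(1 + ⌊log_p e_w⌋)` at every bad
place — literally the per-prime hypothesis `hplace` of `sliver_sum_lt` / `sliver` below. [claim: Mochizuki2012, status: disputed] — nothing asserted. -/
theorem localHeight_lt_of_hBand_pilotDataOfK (h : HBand (pilotDataOfK D K)) (pp : Nat.Primes)
    (w : (thetaIndex (pilotDataOfK D K)).Fibre (.inr pp))
    (hw : haveI : Fact (pp : ℕ).Prime := ⟨pp.2⟩; placeOf (pilotDataOfK D K) pp.1 w ∈ (pilotDataOfK D K).S) :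
    haveI : Fact (pp : ℕ).Prime := ⟨pp.2⟩
    ((l : ℝ) - 3) * ((qParamOrd E (finBelow F K (placeOf (pilotDataOfK D K) pp.1 w)) : ℝ) /
        (ramIdx F (finBelow F K (placeOf (pilotDataOfK D K) pp.1 w)) : ℝ)) <
      4 * (l : ℝ) * (1 + ((Nat.log (pp : ℕ) (ramIdx K (placeOf (pilotDataOfK D K) pp.1 w)) : ℕ) : ℝ)) := by
  haveI hF : Fact (pp : ℕ).Prime := ⟨pp.2⟩
  have key := qParamOrd_lt_of_hBand_pilotDataOfK D h pp w hw
  have h5 : 5 ≤ l := D.five_le_l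
  set n := qParamOrd E (finBelow F K (placeOf (pilotDataOfK D K) pp.1 w)) with hn
  set ev := ramIdx F (finBelow F K (placeOf (pilotDataOfK D K) pp.1 w)) with hev
  set T := Nat.log (pp : ℕ) (ramIdx K (placeOf (pilotDataOfK D K) pp.1 w)) with hT
  have he0 : 0 < ev := Nat.pos_of_ne_zero (ramIdx_ne_zero F _)
  have he0' : (0 : ℝ) < (ev : ℝ) := by exact_mod_cast he0
  have keyR : ((l : ℝ) - 3) * (n : ℝ) < 4 * (l : ℝ) * (ev : ℝ) * (1 + ((T : ℕ) : ℝ)) := by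
    have h' : (((l - 3 : ℕ) : ℝ)) * (n : ℝ) < 4 * (l : ℝ) * (ev : ℝ) * (1 + ((T : ℕ) : ℝ)) := by exact_mod_cast key
    have hsub : (((l - 3 : ℕ) : ℝ)) = (l : ℝ) - 3 := by
      rw [Nat.cast_sub (by omega)]; norm_num
    rw [hsub] at h'
    exact h'
  rw [mul_div_assoc', div_lt_iff₀ he0']
  calc ((l : ℝ) - 3) * (n : ℝ) < 4 * (l : ℝ) * (ev : ℝ) * (1 + ((T : ℕ) : ℝ)) := keyR
    _ = 4 * (l : ℝ) * (1 + ((T : ℕ) : ℝ)) * (ev : ℝ) := by ring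

/-- **`p^{⌊log_p e_w⌋} ≤ e_w` at a bad place** (`e_w ≥ 1`; Mathlib `Nat.pow_log_le_self`, cast to `ℝ`): the hypothesis `hX` of `RHQ3SliverSum.sliver` with
`T_p := ⌊log_p e_w⌋` holds for every real `X ≥ e_w` (e.g. `X = [K:ℚ]`, or `X = E·l` on abc-iut-rh-num-1's tables where `e_w = e_v·l`, `e_v ≤ E`). [folklore] -/
theorem pow_log_ramIdx_le (pp : Nat.Primes) (w : (thetaIndex (pilotDataOfK D K)).Fibre (.inr pp))
    (hw : haveI : Fact (pp : ℕ).Prime := ⟨pp.2⟩; placeOf (pilotDataOfK D K) pp.1 w ∈ (pilotDataOfK D K).S)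
    {X : ℝ} (hX : haveI : Fact (pp : ℕ).Prime := ⟨pp.2⟩; ((ramIdx K (placeOf (pilotDataOfK D K) pp.1 w) : ℝ)) ≤ X) :
    haveI : Fact (pp : ℕ).Prime := ⟨pp.2⟩
    (((pp : ℕ) : ℝ)) ^ (Nat.log (pp : ℕ) (ramIdx K (placeOf (pilotDataOfK D K) pp.1 w))) ≤ X := by
  haveI hF : Fact (pp : ℕ).Prime := ⟨pp.2⟩
  set w₀ := placeOf (pilotDataOfK D K) pp.1 w with hw₀
  have hVF : FinitePlace.mk (finBelow F K w₀) ∈ D.VFbad := (mem_pilotDataOfK_S_iff D K w₀).mp hw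
  have hlr : l ≤ Ideal.ramificationIdx' (finBelow F K w₀).asIdeal w₀.asIdeal :=
    ThetaData.l_le_ramificationIdx_of_under_mem_VFbad D hVF
  have htower : w₀.asIdeal.ramificationIdx ℤ =
      ramIdx F (finBelow F K w₀) * Ideal.ramificationIdx' (finBelow F K w₀).asIdeal w₀.asIdeal :=
    ThetaData.absRamificationIdx_eq_ramIdx_mul (F := F) w₀
  have he0 : 0 < ramIdx F (finBelow F K w₀) := Nat.pos_of_ne_zero (ramIdx_ne_zero F _)
  have h5 : 5 ≤ l := D.five_le_l
  have hew : ramIdx K w₀ ≠ 0 := by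
    rw [ramIdx_eq K w₀, htower]
    exact (Nat.mul_pos he0 (lt_of_lt_of_le (by omega) hlr)).ne'
  have h := Nat.pow_log_le_self (pp : ℕ) hew
  calc (((pp : ℕ) : ℝ)) ^ (Nat.log (pp : ℕ) (ramIdx K w₀)) = (((pp : ℕ) ^ (Nat.log (pp : ℕ) (ramIdx K w₀)) : ℕ) : ℝ) := by push_cast; rfl
    _ ≤ (ramIdx K w₀ : ℝ) := by exact_mod_cast h
    _ ≤ X := hX


end Genuine

end Summit.ABC.IUTFork.Repair.RH.Q3Sliver

end
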